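import Summits.QuantumFields.YangMills.Theorems.BalabanUVNodesPortZDTransportHomogeneity

/-!
# NODE O port, row PT-A′ helper lane (PTZ-1, gen 3): THE WINDOW-MONOTONE BOUND ON AN ADMISSIBLE CLASS — `…PortZDHistoryFluctuation` §3 (`|𝓓_{k+1}(W)| ≤ η_W + η_1`) re-cut with the
# monotonicity of `T` asked only on a CLASS `𝒞` of densities (closed under scaling, containing the two step densities), which is the shape the kernel transform of record INHABITS
# (`𝒞 :=` integrable for the averaging kernel; `…PortZDTransportHomogeneity.transportOfRecord_mono_window`) — the `∀ ρ ρ′` edition of §3 is the special case `𝒞 := ⊤`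

[Balaban1987RG1] = [I] (CMP 109, 1987): (0.13) p. 254, (0.19) p. 255–256, (2.12)–(2.14) p. 268; [Balaban1988RG2Cluster] = [II] (CMP 116, 1988): Lemma 3 (2.38) p. 20, p. 21 («O(1)C₃ε₁»).

Seat `ymgap-nodeO-port-PTZ-1` g3 (prover, HELPER MODE; `--supports stmt-QuantumFields-27930 --as helper`).  Generic layer (0 tokens of the χ-cone of record); CRIT-1 Q-5 (β).
WHY.  §3 of `…PortZDHistoryFluctuation` (✓p805483) displays `hmono : ∀ ρ ρ′, (ρ ≤ ρ′ on S) → T ρ V ≤ T ρ′ V`; for the kernel transform `(Tρ)(V) = h(V)·∫ ρ d(condLaw V)` this holds on INTEGRABLE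
densities only (a non-integrable `ρ′` reads the junk `∫ = 0`), so the honest hypothesis is class-restricted.  This file states the class edition and instantiates it at `transportOfRecord`.
WHAT IS PROVED (0 sorry; no `def` ∕ `instance` ∕ `notation`):
* §1 `transport_integrand_window_le_of_class` ∕ `_ge_of_class`, `abs_log_moment_le_of_window_of_class` — the squeeze and the log-moment bound with `hmono` asked on `𝒞` (displayed:
  `h𝒞A : 𝒞 (I(A))`, `h𝒞F : 𝒞 (I(A + F))`, `h𝒞smul : 𝒞 ρ → 𝒞 (c·ρ)`); ★★ `abs_stepOutT_add_sub_le_of_window_of_class` — `|R_k(A + E)(W) − R_k(A)(W) + E(bg_1)| ≤ η_W + η_1`;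
  ★★ `abs_dChannel_le_of_window_of_class` — `|𝓓_{k+1}(W)| ≤ η_W + η_1` (`GaugeInvariant A_k`, `ε > 0`, `k + 1 ≤ m + K`).
* §2 ★ `hmono_transportOfRecord_integrable` — the kernel transform of record is monotone through any co-null window of `avgKernel V` ON THE CLASS of `avgKernel V`-integrable densities, and
  that class is closed under scaling (`integrable_class_smul`) — the displayed `hmono ∕ h𝒞smul` of §1 INHABITED at `T := transportOfRecord F N K k` (the two memberships `h𝒞A`, `h𝒞F` =
  integrability of the two step densities for the kernel at `W` and at `1`, stay displayed).
HONEST FRAMING.  Order bookkeeping; NOTHING of Bałaban's estimates asserted, ported or discharged; no named fact introduced; 26648 ∕ 27930⁸ SIGNED·OPEN (content-gated), 27931 OPEN (RC-3), 27932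
CLOSED; K0⁷ ∕ K-Ax OPEN; counts unmoved; finite 𝕋⁴ at fixed ε — NOT continuum ∕ OS ∕ Clay; the Yang–Mills mass gap is NOT proved by any of this.  No `sorry`, no `instance`, no `notation`, no `def`.
-/

noncomputable section

open MeasureTheory

namespace Summit.QuantumFields.YangMills.Theorems.PortZD

open Literature.MathematicalPhysics.QuantumFieldTheory.Balaban1983to89
open Literature.MathematicalPhysics.QuantumFieldTheory.Balaban1983to89.Node00
open Literature.MathematicalPhysics.QuantumFieldTheory.Balaban1983to89.Node00.ZeroInput
open T4Continuum (T4Family)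
open B12Eq019ActionBody (nextAction normConst integrand integrand_apply)
open GaugeField (GaugeInvariant)

/-! ## §1. The squeeze and the channel bound with monotonicity on a class -/

section Class

variable {P : Params} {G : Type*} {k : ℕ}

/-- Upper squeeze on a class: `T` homogeneous and monotone through `S` at `V` ON `𝒞`; `I(A + F), e^{η}·I(A) ∈ 𝒞`; `0 ≤ χ`; `F ≤ η` on `S ∩ supp χ` ⇒ `T(I(A + F))(V) ≤ e^{η}·T(I(A))(V)`.
[cite: Balaban1988RG2Cluster, Lemma 3 (2.38) p.20 (mechanism; bookkeeping)] -/
theorem transport_integrand_window_le_of_class {T : Density P k G → Density P (k + 1) G} {𝒞 : Density P k G → Prop} {S : Set (GaugeField P k G)}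
    {V : GaugeField P (k + 1) G} (hT : ∀ (a : ℝ) (ρ : Density P k G), T (fun U => a * ρ U) = fun V => a * T ρ V)
    (hmono : ∀ ρ ρ' : Density P k G, 𝒞 ρ → 𝒞 ρ' → (∀ U ∈ S, ρ U ≤ ρ' U) → T ρ V ≤ T ρ' V)
    (h𝒞smul : ∀ (c : ℝ) (ρ : Density P k G), 𝒞 ρ → 𝒞 (fun U => c * ρ U))
    (χ GF : Density P k G) (hχ : ∀ U, 0 ≤ χ U) (gk : ℝ) (A F : Density P k G) (h𝒞A : 𝒞 (integrand χ GF gk A)) (h𝒞F : 𝒞 (integrand χ GF gk (A + F)))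
    {η : ℝ} (hF : ∀ U ∈ S, χ U ≠ 0 → F U ≤ η) :
    T (integrand χ GF gk (A + F)) V ≤ Real.exp η * T (integrand χ GF gk A) V := by
  have h := congrFun (hT (Real.exp η) (integrand χ GF gk A)) V
  rw [← h]
  refine hmono _ _ h𝒞F (h𝒞smul _ _ h𝒞A) fun U hU => ?_
  by_cases hχ0 : χ U = 0
  · simp [integrand_apply, hχ0]
  · rw [integrand_apply, integrand_apply, Pi.add_apply, ← add_assoc, Real.exp_add]
    calc χ U * (Real.exp (-(1 / gk ^ 2) * GF U + A U) * Real.exp (F U))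
        ≤ χ U * (Real.exp (-(1 / gk ^ 2) * GF U + A U) * Real.exp η) :=
          mul_le_mul_of_nonneg_left (mul_le_mul_of_nonneg_left (Real.exp_le_exp.2 (hF U hU hχ0)) (Real.exp_pos _).le) (hχ U)
      _ = Real.exp η * (χ U * Real.exp (-(1 / gk ^ 2) * GF U + A U)) := by ring

/-- Lower squeeze on a class: `−η ≤ F` on `S ∩ supp χ` ⇒ `e^{−η}·T(I(A))(V) ≤ T(I(A + F))(V)`. [cite: Balaban1988RG2Cluster, Lemma 3 (2.38) p.20 (mechanism; bookkeeping)] -/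
theorem transport_integrand_window_ge_of_class {T : Density P k G → Density P (k + 1) G} {𝒞 : Density P k G → Prop} {S : Set (GaugeField P k G)}
    {V : GaugeField P (k + 1) G} (hT : ∀ (a : ℝ) (ρ : Density P k G), T (fun U => a * ρ U) = fun V => a * T ρ V)
    (hmono : ∀ ρ ρ' : Density P k G, 𝒞 ρ → 𝒞 ρ' → (∀ U ∈ S, ρ U ≤ ρ' U) → T ρ V ≤ T ρ' V)
    (h𝒞smul : ∀ (c : ℝ) (ρ : Density P k G), 𝒞 ρ → 𝒞 (fun U => c * ρ U))
    (χ GF : Density P k G) (hχ : ∀ U, 0 ≤ χ U) (gk : ℝ) (A F : Density P k G) (h𝒞A : 𝒞 (integrand χ GF gk A)) (h𝒞F : 𝒞 (integrand χ GF gk (A + F)))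
    {η : ℝ} (hF : ∀ U ∈ S, χ U ≠ 0 → -η ≤ F U) :
    Real.exp (-η) * T (integrand χ GF gk A) V ≤ T (integrand χ GF gk (A + F)) V := by
  have h := congrFun (hT (Real.exp (-η)) (integrand χ GF gk A)) V
  rw [← h]
  refine hmono _ _ (h𝒞smul _ _ h𝒞A) h𝒞F fun U hU => ?_
  by_cases hχ0 : χ U = 0
  · simp [integrand_apply, hχ0]
  · rw [integrand_apply, integrand_apply, Pi.add_apply, ← add_assoc]
    calc Real.exp (-η) * (χ U * Real.exp (-(1 / gk ^ 2) * GF U + A U))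
        = χ U * (Real.exp (-(1 / gk ^ 2) * GF U + A U) * Real.exp (-η)) := by ring
      _ ≤ χ U * (Real.exp (-(1 / gk ^ 2) * GF U + A U) * Real.exp (F U)) :=
          mul_le_mul_of_nonneg_left (mul_le_mul_of_nonneg_left (Real.exp_le_exp.2 (hF U hU hχ0)) (Real.exp_pos _).le) (hχ U)
      _ = χ U * Real.exp (-(1 / gk ^ 2) * GF U + A U + F U) := by rw [← Real.exp_add]

/-- The log-moment bound on a class: `|F| ≤ η` on `S ∩ supp χ`, `T(I(A))(V) > 0` ⇒ `|log[T(I(A + F))(V) ∕ T(I(A))(V)]| ≤ η`. [cite: Balaban1988RG2Cluster, Lemma 3 (2.38) p.20, p.21 (bookkeeping)] -/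
theorem abs_log_moment_le_of_window_of_class {T : Density P k G → Density P (k + 1) G} {𝒞 : Density P k G → Prop} {S : Set (GaugeField P k G)}
    {V : GaugeField P (k + 1) G} (hT : ∀ (a : ℝ) (ρ : Density P k G), T (fun U => a * ρ U) = fun V => a * T ρ V)
    (hmono : ∀ ρ ρ' : Density P k G, 𝒞 ρ → 𝒞 ρ' → (∀ U ∈ S, ρ U ≤ ρ' U) → T ρ V ≤ T ρ' V)
    (h𝒞smul : ∀ (c : ℝ) (ρ : Density P k G), 𝒞 ρ → 𝒞 (fun U => c * ρ U))
    (χ GF : Density P k G) (hχ : ∀ U, 0 ≤ χ U) (gk : ℝ) (A F : Density P k G) (h𝒞A : 𝒞 (integrand χ GF gk A)) (h𝒞F : 𝒞 (integrand χ GF gk (A + F)))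
    {η : ℝ} (hF : ∀ U ∈ S, χ U ≠ 0 → |F U| ≤ η) (hA : 0 < T (integrand χ GF gk A) V) :
    |Real.log (T (integrand χ GF gk (A + F)) V / T (integrand χ GF gk A) V)| ≤ η := by
  have hup := transport_integrand_window_le_of_class hT hmono h𝒞smul χ GF hχ gk A F h𝒞A h𝒞F (fun U hU hχ0 => (abs_le.1 (hF U hU hχ0)).2)
  have hlo := transport_integrand_window_ge_of_class hT hmono h𝒞smul χ GF hχ gk A F h𝒞A h𝒞F (fun U hU hχ0 => (abs_le.1 (hF U hU hχ0)).1)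
  have hpos : 0 < T (integrand χ GF gk (A + F)) V := lt_of_lt_of_le (mul_pos (Real.exp_pos _) hA) hlo
  rw [abs_le]
  constructor
  · rw [← Real.log_exp (-η)]
    exact Real.log_le_log (Real.exp_pos _) ((le_div_iff₀ hA).2 hlo)
  · rw [← Real.log_exp η]
    exact Real.log_le_log (div_pos hpos hA) ((div_le_iff₀ hA).2 hup)

end Class

variable (F : T4Family) (N : ℕ) [NeZero N]

/-- ★★ **`|R_k(A + E)(W) − R_k(A)(W) + E(bg_1)| ≤ η_W + η_1` WITH MONOTONICITY ON A CLASS** (`𝒞W` at `W`, `𝒞1` at `1`; memberships of `I(A)` and of `I(A + (E − E(bg_V)))` displayed).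
[cite: Balaban1988RG2Cluster, Lemma 3 (2.38) p.20, p.21; Balaban1987RG1, (2.12)–(2.14) p.268] -/
theorem abs_stepOutT_add_sub_le_of_window_of_class (T : Transport F N) (χ : (K : ℕ) → (ℕ → ℝ) → (k : ℕ) → Density (F.P K) k (SU N)) (ε : ℝ)
    (K : ℕ) (g : ℕ → ℝ) (k : ℕ) (hT : ∀ (a : ℝ) (ρ : Density (F.P K) k (SU N)), T K k (fun U => a * ρ U) = fun V => a * T K k ρ V)
    (hχ : ∀ U, 0 ≤ χ K g k U) {𝒞W 𝒞1 : Density (F.P K) k (SU N) → Prop} {S S₁ : Set (GaugeField (F.P K) k (SU N))} (A E : Density (F.P K) k (SU N))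
    (W : GaugeField (F.P K) (k + 1) (SU N))
    (hmonoW : ∀ ρ ρ' : Density (F.P K) k (SU N), 𝒞W ρ → 𝒞W ρ' → (∀ U ∈ S, ρ U ≤ ρ' U) → T K k ρ W ≤ T K k ρ' W)
    (hmono1 : ∀ ρ ρ' : Density (F.P K) k (SU N), 𝒞1 ρ → 𝒞1 ρ' → (∀ U ∈ S₁, ρ U ≤ ρ' U) → T K k ρ 1 ≤ T K k ρ' 1)
    (h𝒞Wsmul : ∀ (c : ℝ) (ρ : Density (F.P K) k (SU N)), 𝒞W ρ → 𝒞W (fun U => c * ρ U))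
    (h𝒞1smul : ∀ (c : ℝ) (ρ : Density (F.P K) k (SU N)), 𝒞1 ρ → 𝒞1 (fun U => c * ρ U))
    (h𝒞WA : 𝒞W (integrand (χ K g k) (gfOfRecord F N K k) (g k) A))
    (h𝒞1A : 𝒞1 (integrand (χ K g k) (gfOfRecord F N K k) (g k) A))
    (h𝒞WF : 𝒞W (integrand (χ K g k) (gfOfRecord F N K k) (g k) (A + fun U => E U - E (Averaging.iter (avOfRecord F N K) k (Uk F N K (k + 1) ε W)))))
    (h𝒞1F : 𝒞1 (integrand (χ K g k) (gfOfRecord F N K k) (g k) (A + fun U => E U - E (Averaging.iter (avOfRecord F N K) k (Uk F N K (k + 1) ε 1)))))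
    (hAW : 0 < T K k (integrand (χ K g k) (gfOfRecord F N K k) (g k) A) W)
    (hA1 : 0 < T K k (integrand (χ K g k) (gfOfRecord F N K k) (g k) A) 1) {ηW η1 : ℝ}
    (hEW : ∀ U ∈ S, χ K g k U ≠ 0 → |E U - E (Averaging.iter (avOfRecord F N K) k (Uk F N K (k + 1) ε W))| ≤ ηW)
    (hE1 : ∀ U ∈ S₁, χ K g k U ≠ 0 → |E U - E (Averaging.iter (avOfRecord F N K) k (Uk F N K (k + 1) ε 1))| ≤ η1) :
    |stepOutT F N T χ ε K g k (A + E) W - stepOutT F N T χ ε K g k A W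
        + E (Averaging.iter (avOfRecord F N K) k (Uk F N K (k + 1) ε 1))| ≤ ηW + η1 := by
  set cW := E (Averaging.iter (avOfRecord F N K) k (Uk F N K (k + 1) ε W)) with hcW
  set c1 := E (Averaging.iter (avOfRecord F N K) k (Uk F N K (k + 1) ε 1)) with hc1
  have hloW := transport_integrand_window_ge_of_class hT hmonoW h𝒞Wsmul (χ K g k) (gfOfRecord F N K k) hχ (g k) A (fun U => E U - cW) h𝒞WA h𝒞WF
    (fun U hU hχ0 => (abs_le.1 (hEW U hU hχ0)).1)
  have hlo1 := transport_integrand_window_ge_of_class hT hmono1 h𝒞1smul (χ K g k) (gfOfRecord F N K k) hχ (g k) A (fun U => E U - c1) h𝒞1A h𝒞1F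
    (fun U hU hχ0 => (abs_le.1 (hE1 U hU hχ0)).1)
  have hXW : 0 < T K k (integrand (χ K g k) (gfOfRecord F N K k) (g k) (A + fun U => E U - cW)) W :=
    lt_of_lt_of_le (mul_pos (Real.exp_pos _) hAW) hloW
  have hX1 : 0 < T K k (integrand (χ K g k) (gfOfRecord F N K k) (g k) (A + fun U => E U - c1)) 1 :=
    lt_of_lt_of_le (mul_pos (Real.exp_pos _) hA1) hlo1
  have hEW' : 0 < T K k (integrand (χ K g k) (gfOfRecord F N K k) (g k) (A + E)) W := by
    rw [transport_integrand_add_recentre hT _ _ _ A E cW W]; exact mul_pos (Real.exp_pos _) hXW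
  have hE1' : 0 < T K k (integrand (χ K g k) (gfOfRecord F N K k) (g k) (A + E)) 1 := by
    rw [transport_integrand_add_recentre hT _ _ _ A E c1 1]; exact mul_pos (Real.exp_pos _) hX1
  rw [stepOutT_add_sub_eq_log_fluct F N T χ ε K g k hT A E W hAW hA1 hEW' hE1', sub_add_cancel]
  have h₁ := abs_log_moment_le_of_window_of_class hT hmonoW h𝒞Wsmul (χ K g k) (gfOfRecord F N K k) hχ (g k) A (fun U => E U - cW) h𝒞WA h𝒞WF hEW hAW
  have h₂ := abs_log_moment_le_of_window_of_class hT hmono1 h𝒞1smul (χ K g k) (gfOfRecord F N K k) hχ (g k) A (fun U => E U - c1) h𝒞1A h𝒞1F hE1 hA1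
  exact (abs_sub _ _).trans (add_le_add h₁ h₂)

/-- ★★ **`|𝓓_{k+1}(W)| ≤ η_W + η_1` WITH MONOTONICITY ON A CLASS** — `GaugeInvariant A_k` (unit normalisation), `0 ≤ χ_k`, `ε > 0`, `k + 1 ≤ m + K`; `T K k` homogeneous and monotone through the
windows on the classes; the zero-input step defined at `W`, `1`; the four memberships displayed. [cite: Balaban1988RG2Cluster, Lemma 3 (2.38) p.20, p.21; Balaban1987RG1, (1.6) p.261, (2.12)–(2.14) p.268] -/
theorem abs_dChannel_le_of_window_of_class (T : Transport F N) (χ : (K : ℕ) → (ℕ → ℝ) → (k : ℕ) → Density (F.P K) k (SU N)) {ε : ℝ} (hε : 0 < ε)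
    {K : ℕ} (g : ℕ → ℝ) {k : ℕ} (hk : k + 1 ≤ (F.P K).m + (F.P K).K)
    (hT : ∀ (a : ℝ) (ρ : Density (F.P K) k (SU N)), T K k (fun U => a * ρ U) = fun V => a * T K k ρ V)
    (hχ : ∀ U, 0 ≤ χ K g k U) (hinv : GaugeInvariant (effActionHT F N T χ K g k)) {𝒞W 𝒞1 : Density (F.P K) k (SU N) → Prop}
    {S S₁ : Set (GaugeField (F.P K) k (SU N))} (W : GaugeField (F.P K) (k + 1) (SU N))
    (hmonoW : ∀ ρ ρ' : Density (F.P K) k (SU N), 𝒞W ρ → 𝒞W ρ' → (∀ U ∈ S, ρ U ≤ ρ' U) → T K k ρ W ≤ T K k ρ' W)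
    (hmono1 : ∀ ρ ρ' : Density (F.P K) k (SU N), 𝒞1 ρ → 𝒞1 ρ' → (∀ U ∈ S₁, ρ U ≤ ρ' U) → T K k ρ 1 ≤ T K k ρ' 1)
    (h𝒞Wsmul : ∀ (c : ℝ) (ρ : Density (F.P K) k (SU N)), 𝒞W ρ → 𝒞W (fun U => c * ρ U))
    (h𝒞1smul : ∀ (c : ℝ) (ρ : Density (F.P K) k (SU N)), 𝒞1 ρ → 𝒞1 (fun U => c * ρ U))
    (h𝒞WA : 𝒞W (integrand (χ K g k) (gfOfRecord F N K k) (g k) (mainTermT F N ε K g k)))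
    (h𝒞1A : 𝒞1 (integrand (χ K g k) (gfOfRecord F N K k) (g k) (mainTermT F N ε K g k)))
    (h𝒞WF : 𝒞W (integrand (χ K g k) (gfOfRecord F N K k) (g k) (mainTermT F N ε K g k + fun U => EkT F N T χ ε K g k U -
      EkT F N T χ ε K g k (Averaging.iter (avOfRecord F N K) k (Uk F N K (k + 1) ε W)))))
    (h𝒞1F : 𝒞1 (integrand (χ K g k) (gfOfRecord F N K k) (g k) (mainTermT F N ε K g k + fun U => EkT F N T χ ε K g k U - EkT F N T χ ε K g k 1)))
    (h0W : 0 < T K k (integrand (χ K g k) (gfOfRecord F N K k) (g k) (mainTermT F N ε K g k)) W)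
    (h01 : 0 < T K k (integrand (χ K g k) (gfOfRecord F N K k) (g k) (mainTermT F N ε K g k)) 1) {ηW η1 : ℝ}
    (hEW : ∀ U ∈ S, χ K g k U ≠ 0 →
      |EkT F N T χ ε K g k U - EkT F N T χ ε K g k (Averaging.iter (avOfRecord F N K) k (Uk F N K (k + 1) ε W))| ≤ ηW)
    (hE1 : ∀ U ∈ S₁, χ K g k U ≠ 0 → |EkT F N T χ ε K g k U - EkT F N T χ ε K g k 1| ≤ η1) :
    |mergedTermT F N T χ ε K g k W - zeroInputMergedTermT F N T χ ε K g k W| ≤ ηW + η1 := by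
  have h0 := EkT_iter_Uk_one_of_gaugeInvariant F N T χ hε g hk hinv
  have h1u := EkT_one F N T χ hε K g k
  have hE1' : ∀ U ∈ S₁, χ K g k U ≠ 0 →
      |EkT F N T χ ε K g k U - EkT F N T χ ε K g k (Averaging.iter (avOfRecord F N K) k (Uk F N K (k + 1) ε 1))| ≤ η1 := by
    intro U hU hχ0; rw [h0, ← h1u]; exact hE1 U hU hχ0
  have h𝒞1F' : 𝒞1 (integrand (χ K g k) (gfOfRecord F N K k) (g k) (mainTermT F N ε K g k + fun U => EkT F N T χ ε K g k U -
      EkT F N T χ ε K g k (Averaging.iter (avOfRecord F N K) k (Uk F N K (k + 1) ε 1)))) := by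
    rw [h0, ← h1u]; exact h𝒞1F
  have h := abs_stepOutT_add_sub_le_of_window_of_class F N T χ ε K g k hT hχ (mainTermT F N ε K g k) (EkT F N T χ ε K g k) W hmonoW hmono1
    h𝒞Wsmul h𝒞1smul h𝒞WA h𝒞1A h𝒞WF h𝒞1F' h0W h01 hEW hE1'
  rwa [h0, add_zero, ← effActionHT_eq_main_add_Ek_fun F N T χ ε K g k, ← mergedTermT_eq_stepOut, ← zeroInputMergedTermT_eq_stepOut] at h

/-! ## §2. The kernel transform of record inhabits the class edition: monotone on the integrable densities of the averaging kernel -/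

/-- ★ **The displayed `hmono` INHABITED at the kernel transform**: through a co-null window `S` of `avgKernel V`, `transportOfRecord F N K k` is monotone ON THE CLASS of
`avgKernel V`-integrable densities. [cite: Balaban1987RG1, (0.13) p.254; Balaban1988Convergent, (3.1) p.264 (bookkeeping)] -/
theorem hmono_transportOfRecord_integrable {K k : ℕ} {S : Set (GaugeField (F.P K) k (SU N))} {V : GaugeField (F.P K) (k + 1) (SU N)}
    (hS : T4AveragingDisintegration.avgKernel (avOfRecord F N K k).avg V Sᶜ = 0) :
    ∀ ρ ρ' : Density (F.P K) k (SU N), Integrable ρ (T4AveragingDisintegration.avgKernel (avOfRecord F N K k).avg V) →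
      Integrable ρ' (T4AveragingDisintegration.avgKernel (avOfRecord F N K k).avg V) → (∀ U ∈ S, ρ U ≤ ρ' U) →
      transportOfRecord F N K k ρ V ≤ transportOfRecord F N K k ρ' V :=
  fun _ _ hρ hρ' h => transportOfRecord_mono_window F N hS hρ hρ' h

/-- The class of `avgKernel V`-integrable densities is closed under scaling (the displayed `h𝒞smul`). [cite: Balaban1988Convergent, (3.1) p.264 (bookkeeping)] -/
theorem integrable_class_smul {K k : ℕ} {V : GaugeField (F.P K) (k + 1) (SU N)} :
    ∀ (c : ℝ) (ρ : Density (F.P K) k (SU N)), Integrable ρ (T4AveragingDisintegration.avgKernel (avOfRecord F N K k).avg V) →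
      Integrable (fun U => c * ρ U) (T4AveragingDisintegration.avgKernel (avOfRecord F N K k).avg V) :=
  fun c _ hρ => hρ.const_mul c

end Summit.QuantumFields.YangMills.Theorems.PortZD

end
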